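import Mathlib
import HarnessLib
import Literature.AlgebraicGeometry.Resolution.AffineBlowup
import Summits.ResolutionOfSingularities.ResolutionOfSingularities.Theorems.WildQuotientsWildQuotientResolutionToricExitProjMap

/-!
# Equivariance of chart-ring models: the E-engine for the cone bricks
(crux stmt-ResolutionOfSingularities-15640 `WildQuotients.WildQuotientResolution`, line `Sketch`;
chain w45c programmes V3U/V4U, CHAIN v7.3 §4 (stub-3 row E «equivariance lemmas», input via
stub-5's …ToricExitProjMap (B′)); written by res-D-pv-033 AS res-L1-w45c-stub-5;
[OURS · L1 W4.5c] — generic commutative algebra, NOT a statement of any manuscript.)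

Setting: `I ⊆ R`, `τ : R → R` with `τ(I) ⊆ I`, `φ` the coefficientwise graded endomorphism of the Rees
algebra (`ToricExit.exists_reesGradedHom`), `b ∈ I` with `τ b = b` (an INVARIANT chart: `x_a`,
`x_a²`, `T′`). By …ToricExitProjMap (`awayToSection_comp_appLE_liftAction`) the lifted action on
the sections `Γ(Bl, D₊(bt)) ≅ (R[It])_{(bt)}` is the ring ENDOmorphism
`ψ := HomogeneousLocalization.map φ _` of the chart ring. This file computes `ψ` in any MODEL of the
chart ring:

* `ToricExit.reesGradedHom_reesT_eq_self`, `ToricExit.powers_reesT_le_comap` — `φ(bt) = bt`, so `ψ`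
  is defined;
* `ToricExit.map_reesChartBase` — `ψ(r/1) = τ(r)/1`;
* `ToricExit.awayMk_mul_reesChartBase_pow` — `(x tⁿ)/(bt)ⁿ · (b/1)ⁿ = x/1` (every element of the
  chart ring becomes a degree-`0` element after multiplication by a power of the non-zero-divisor
  `b/1`);
* `ToricExit.map_away_eq_of_intertwines` — **the E-engine**: for ANY ring hom `e` from the chart
  ring to a ring `S` in which `e(b/1)` is a non-zero-divisor, and any `Σ : S → S` (`Sg`) with
  `Σ(e(r/1)) = e(τ(r)/1)` for all `r ∈ R`, one has `e ∘ ψ = Σ ∘ e` (cancellation by `(b/1)ⁿ`).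
So the equivariance of a chart model `e` (D3 p486657 for `x_a`; p490009 for `x_a²`; T2(b) for `T′`)
reduces to the root-chart intertwining `Σ ∘ ψ₀ = ψ₀ ∘ τ` on `R = k[x]`.
-/

-- single-problem summit: the doubled namespace component `ResolutionOfSingularities` is forced
set_option linter.dupNamespace false

noncomputable section

open Polynomial HomogeneousLocalization
open Literature.AlgebraicGeometry.Resolution

namespace Summit.ResolutionOfSingularities.ResolutionOfSingularities.Theorems.WildQuotientResolution.ToricExit

universe u

variable {R : Type u} [CommRing R] {I : Ideal R}
  (φ : reesGrading I →+*ᵍ reesGrading I) (τ : R →+* R)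
  (hφ : ∀ x : reesAlgebra I, ((φ x : reesAlgebra I) : R[X]) = (x : R[X]).map τ)
  (b : R) (hb : b ∈ I) (hτb : τ b = b)

include hφ hτb in
/-- `φ` fixes `bt` when `τ b = b`. [folklore] -/
theorem reesGradedHom_reesT_eq_self : φ (reesT b hb) = reesT b hb := by
  apply Subtype.ext
  rw [hφ, coe_reesT, Polynomial.map_monomial, hτb]

include hφ hτb in
/-- The powers of `bt` are mapped into themselves by `φ` (so `HomogeneousLocalization.map φ` is an
endomorphism of `(R[It])_{(bt)}`). [folklore] -/
theorem powers_reesT_le_comap :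
    Submonoid.powers (reesT b hb) ≤ (Submonoid.powers (reesT b hb)).comap φ := by
  rintro _ ⟨n, rfl⟩
  refine ⟨n, ?_⟩
  change reesT b hb ^ n = φ (reesT b hb ^ n)
  rw [map_pow, reesGradedHom_reesT_eq_self φ τ hφ b hb hτb]

include hφ in
/-- **`ψ(r/1) = τ(r)/1`** for `ψ = HomogeneousLocalization.map φ`. [folklore] -/
theorem map_reesChartBase (hP : Submonoid.powers (reesT b hb) ≤ (Submonoid.powers (reesT b hb)).comap φ)
    (r : R) :
    HomogeneousLocalization.map φ hP (reesChartBase b hb r) = reesChartBase b hb (τ r) := by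
  apply HomogeneousLocalization.val_injective
  change (HomogeneousLocalization.map φ hP (HomogeneousLocalization.mk _)).val =
    (HomogeneousLocalization.mk _).val
  rw [HomogeneousLocalization.map_mk, HomogeneousLocalization.val_mk, HomogeneousLocalization.val_mk]
  dsimp only
  congr 1
  · change (φ ((reesGrading.zeroRingHom I r : reesGrading I 0) : reesAlgebra I) : reesAlgebra I) =
      ((reesGrading.zeroRingHom I (τ r) : reesGrading I 0) : reesAlgebra I)
    rw [reesGrading.coe_zeroRingHom, reesGrading.coe_zeroRingHom, reesGradedHom_algebraMap φ τ hφ]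
  · exact Subtype.ext (map_one φ)

/-- **`(x tⁿ)/(bt)ⁿ · (b/1)ⁿ = r/1`** for `x = r tⁿ`. [folklore] -/
theorem awayMk_mul_reesChartBase_pow (n : ℕ) (x : reesAlgebra I)
    (hx : x ∈ reesGrading I (n • 1)) (r : R) (hxr : (x : R[X]) = monomial n r) :
    HomogeneousLocalization.Away.mk (reesGrading I) (reesT_mem b hb) n x hx * reesChartBase b hb b ^ n =
      reesChartBase b hb r := by
  apply HomogeneousLocalization.val_injective
  rw [HomogeneousLocalization.val_mul, HomogeneousLocalization.val_pow,
    HomogeneousLocalization.Away.val_mk, val_reesChartBase_eq_mk, val_reesChartBase_eq_mk,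
    Localization.mk_pow, Localization.mk_mul, Localization.mk_eq_mk_iff, Localization.r_iff_exists]
  refine ⟨1, ?_⟩
  simp only [OneMemClass.coe_one, one_mul, one_pow, mul_one]
  apply Subtype.ext
  simp only [Subalgebra.coe_mul, Subalgebra.coe_pow, hxr, coe_reesT, Subalgebra.coe_algebraMap,
    Polynomial.algebraMap_apply, ← C_mul_X_pow_eq_monomial, Algebra.algebraMap_self_apply]
  ring

include hφ hτb in
/-- **The E-engine: equivariance of chart models.** Let `ψ = HomogeneousLocalization.map φ` be the
endomorphism of the chart ring `(R[It])_{(bt)}` induced by `τ` (`τ b = b`), `e` a ring homomorphism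
from the chart ring to a ring `S` in which `e(b/1)` is a non-zero-divisor, and `Σ` an endomorphism
of `S` with `Σ(e(r/1)) = e(τ(r)/1)` for all `r`. Then `e(ψ y) = Σ(e y)` for every `y`.
[folklore] -/
theorem map_away_eq_of_intertwines
    (hP : Submonoid.powers (reesT b hb) ≤ (Submonoid.powers (reesT b hb)).comap φ)
    {S : Type*} [CommRing S] (e : HomogeneousLocalization.Away (reesGrading I) (reesT b hb) →+* S)
    (hnzd : e (reesChartBase b hb b) ∈ nonZeroDivisors S) (Sg : S →+* S)
    (hSg : ∀ r : R, Sg (e (reesChartBase b hb r)) = e (reesChartBase b hb (τ r)))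
    (y : HomogeneousLocalization.Away (reesGrading I) (reesT b hb)) :
    e (HomogeneousLocalization.map φ hP y) = Sg (e y) := by
  obtain ⟨n, x, hx, rfl⟩ := HomogeneousLocalization.Away.mk_surjective (reesGrading I) (reesT_mem b hb) y
  obtain ⟨r, hr⟩ := (mem_reesGrading_iff I).mp (by simpa using hx)
  have key := awayMk_mul_reesChartBase_pow b hb n x hx r hr.symm
  have hbn : e (reesChartBase b hb b) ^ n ∈ nonZeroDivisors S := pow_mem hnzd n
  rw [← mul_cancel_right_mem_nonZeroDivisors hbn]
  have h1 : e (HomogeneousLocalization.map φ hP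
      (HomogeneousLocalization.Away.mk (reesGrading I) (reesT_mem b hb) n x hx)) *
        e (reesChartBase b hb b) ^ n =
      e (reesChartBase b hb (τ r)) := by
    have h0 : HomogeneousLocalization.map φ hP (reesChartBase b hb b) = reesChartBase b hb b := by
      rw [map_reesChartBase φ τ hφ b hb hP, hτb]
    rw [← h0, ← map_pow, ← map_pow, ← map_mul, ← map_mul, key, map_reesChartBase φ τ hφ b hb hP r]
  have h2 : Sg (e (HomogeneousLocalization.Away.mk (reesGrading I) (reesT_mem b hb) n x hx)) *
        e (reesChartBase b hb b) ^ n =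
      e (reesChartBase b hb (τ r)) := by
    have h3 : Sg (e (reesChartBase b hb b)) = e (reesChartBase b hb b) := by rw [hSg, hτb]
    rw [← h3, ← map_pow, ← map_mul, ← map_pow, ← map_mul, key, hSg]
  rw [h1, h2]

end Summit.ResolutionOfSingularities.ResolutionOfSingularities.Theorems.WildQuotientResolution.ToricExit

end
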